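import Summits.ResolutionOfSingularities.ResolutionOfSingularities.Theorems.WeightedInvariantHypersurfaceLocalGameEFTDimTwoNewton
import Summits.ResolutionOfSingularities.ResolutionOfSingularities.Theorems.WeightedInvariantRegularSubschemeCentre
import HarnessLib

/-!
# The e.f.t. local weighted game (door `HypersurfaceCentreConstruction`): Newton data along a SUB-family of parameters

Topic: `Summits/ResolutionOfSingularities/ResolutionOfSingularities/Theorems`. Helper for the door item
`HypersurfaceCentreConstruction` (statement `stmt-ResolutionOfSingularities-19897`, route `WeightedInvariant`),
line `local-engine` of `res-L1-w43-plan-1` (L W4.3), ORDER (o36) «(P3a-drop) over the special point» held by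
res-type-092 (design memo `plan/tools/res-type-092/o36/O36-DESIGN.md`, §7 «P3a°-drop»).

K5 (`…EFTDimTwoNewton`, `LocalGameEFTNewton.le_weight_of_mem_weightedMonomialIdeal`) reads the weighted filtration of a
FULL regular system of parameters `u` (`span (range u) = 𝔪`, `dim S = d`) on a unit expansion `f = Σ_{α ∈ Δ} a_α u^α + r`,
`r ∈ 𝔪^N`.  The P3a move needs the same statement for a SUB-family `u : Fin d → S` of a regular system of parameters
(`u i ∈ 𝔪` with linearly independent images in `𝔪 ⧸ 𝔪²`; e.g. `(t⁻¹, z, Y')` in the four-dimensional successor ring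
`B_𝔫`, or `(x, y)` in the three-dimensional `S`), where `𝔪^N ⊄ 𝒥_N(u; w)`: the remainder must then be taken in
`(u)^N` instead of `𝔪^N`, and weighted quasi-regularity (tree `weightedQuasiRegular_of_linearIndependent_toCotangent`,
[Matsumura1987, Thm. 16.2]) puts the layer coefficients in the ideal `(u) ⊆ 𝔪` — still incompatible with a unit.

* `coeff_layer_sub_mem_span` — the weight-`k` layer of an expansion with remainder in `(u)^N` is determined modulo `(u)`;
* **`le_weight_of_mem_weightedMonomialIdeal_of_linearIndependent`** — `f ∈ 𝒥ₘ(u; w)`, `m ≤ N` ⇒ `w·α ≥ m` on `Δ`;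
* `exists_weight_lt_of_not_mem_of_linearIndependent` — the contrapositive witness;
* `not_mem_pow_span_of_degree_lt` — with all weights `1` (tree `weightedMonomialIdeal_one_eq_pow`): a unit monomial of degree `< m` keeps `f` out of `(u)^m`.

[OURS · L1 W4.3] Replaces the role of NO printed item; NOT a statement of the manuscript under review (Hironaka 2017).
AI work, weaker than expert review. Def-free; `--supports stmt-ResolutionOfSingularities-19897 --as helper`.

## References

* H. Matsumura, *Commutative Ring Theory*, Thm. 16.2 (quasi-regular sequences), Thm. 14.2. [Matsumura1987]
* J. Włodarczyk, *Functorial resolution by torus actions*, arXiv:2203.03090, Lemma 2.1.12. [Wlodarczyk2022]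
-/

noncomputable section

open IsLocalRing Literature.AlgebraicGeometry.Resolution

set_option linter.dupNamespace false -- mandated namespace of this single-conjunct summit

namespace Summit.ResolutionOfSingularities.ResolutionOfSingularities.Theorems

namespace LocalGameEFTNewton

universe u

variable {S : Type u} [CommRing S]

section SpanPow

variable {d : ℕ} (u : Fin d → S)

/-- **Easy converse (any commutative ring).**  For an expansion with remainder in `(u)^N`: if every exponent of
`Δ` has weight `≥ m` (`m ≤ N`) then `f ∈ 𝒥ₘ(u; w)`. [folklore] -/
theorem mem_weightedMonomialIdeal_of_forall_le_weight_span (w : Fin d → ℕ) (hw : ∀ i, 0 < w i) {f : S}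
    {Δ : Finset (Fin d → ℕ)} {a : (Fin d → ℕ) → S} {N m : ℕ} (hr : f - ∑ α ∈ Δ, a α * ∏ i, u i ^ α i ∈ Ideal.span (Set.range u) ^ N)
    (hge : ∀ α ∈ Δ, m ≤ ∑ i, w i * α i) (hmN : m ≤ N) : f ∈ weightedMonomialIdeal u w m := by
  have hsum : ∑ α ∈ Δ, a α * ∏ i, u i ^ α i ∈ weightedMonomialIdeal u w m :=
    Ideal.sum_mem _ fun α hα => Ideal.mul_mem_left _ _ (prod_pow_mem_weightedMonomialIdeal u w α (hge α hα))
  have hrm : f - ∑ α ∈ Δ, a α * ∏ i, u i ^ α i ∈ weightedMonomialIdeal u w m :=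
    ((Ideal.pow_le_pow_right hmN).trans (pow_le_weightedMonomialIdeal_of_span_eq u w hw rfl m)) hr
  have := Ideal.add_mem _ hrm hsum
  rwa [sub_add_cancel] at this

end SpanPow

section Subfamily

variable [IsRegularLocalRing S] {d : ℕ} (u : Fin d → S) (hmem : ∀ i, u i ∈ maximalIdeal S)
  (hli : LinearIndependent (ResidueField S) fun i => (maximalIdeal S).toCotangent ⟨u i, hmem i⟩)
  (w : Fin d → ℕ) (hw : ∀ i, 0 < w i)

include hli hw in
/-- **The weight-`k` layer of an expansion along a sub-family is determined modulo `(u)`.**  Let `u` be part of a regular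
system of parameters (independent in `𝔪 ⧸ 𝔪²`), `f = Σ_{α ∈ Δ} a_α u^α + r` with `r ∈ (u)^N` (ANY coefficients), all
exponents of `Δ` of weight `≥ k`, `k < N`, and `Q` a `w`-form of weight `k` with `f - Q(u) ∈ 𝒥_{k+1}(u; w)`.  Then the
`w`-form `Σ_{α ∈ Δ, w·α = k} a_α X^α - Q` has all its coefficients in the ideal `(u)`.  [cite: Matsumura1987, Thm. 16.2] -/
theorem coeff_layer_sub_mem_span {f : S} {Δ : Finset (Fin d → ℕ)} {a : (Fin d → ℕ) → S} {N k : ℕ}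
    (hr : f - ∑ α ∈ Δ, a α * ∏ i, u i ^ α i ∈ Ideal.span (Set.range u) ^ N) (hge : ∀ α ∈ Δ, k ≤ ∑ i, w i * α i)
    (hkN : k < N) (Q : MvPolynomial (Fin d) S) (hQ : Q.IsWeightedHomogeneous w k)
    (hfQ : f - MvPolynomial.eval u Q ∈ weightedMonomialIdeal u w (k + 1)) (β : Fin d →₀ ℕ) :
    (∑ α ∈ Δ.filter (fun α => ∑ i, w i * α i = k),
        MvPolynomial.monomial (Finsupp.equivFunOnFinite.symm α) (a α) - Q).coeff β ∈ Ideal.span (Set.range u) := by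
  classical
  set P : MvPolynomial (Fin d) S := ∑ α ∈ Δ.filter (fun α => ∑ i, w i * α i = k),
    MvPolynomial.monomial (Finsupp.equivFunOnFinite.symm α) (a α) with hPdef
  have hP : P.IsWeightedHomogeneous w k := by
    rw [← MvPolynomial.mem_weightedHomogeneousSubmodule]
    refine Submodule.sum_mem _ fun α hα => ?_
    rw [MvPolynomial.mem_weightedHomogeneousSubmodule]
    exact MvPolynomial.isWeightedHomogeneous_monomial w _ (a α)
      (by rw [weight_equivFunOnFinite_symm w, (Finset.mem_filter.mp hα).2])
  have hPQ : (P - Q).IsWeightedHomogeneous w k := by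
    rw [← MvPolynomial.mem_weightedHomogeneousSubmodule] at hP hQ ⊢
    exact Submodule.sub_mem _ hP hQ
  have hJ : Ideal.span (Set.range u) ^ N ≤ weightedMonomialIdeal u w (k + 1) :=
    (Ideal.pow_le_pow_right hkN).trans (pow_le_weightedMonomialIdeal_of_span_eq u w hw rfl (k + 1))
  have hevalP : MvPolynomial.eval u P = ∑ α ∈ Δ.filter (fun α => ∑ i, w i * α i = k), a α * ∏ i, u i ^ α i := by
    simp only [hPdef, map_sum, eval_monomial_equivFunOnFinite_symm u]
  have hhigh : ∑ α ∈ Δ.filter (fun α => ¬ ∑ i, w i * α i = k), a α * ∏ i, u i ^ α i ∈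
      weightedMonomialIdeal u w (k + 1) := by
    refine Ideal.sum_mem _ fun α hα => Ideal.mul_mem_left _ _ ?_
    obtain ⟨hαΔ, hne⟩ := Finset.mem_filter.mp hα
    exact prod_pow_mem_weightedMonomialIdeal u w α (by have := hge α hαΔ; omega)
  have heval : MvPolynomial.eval u (P - Q) ∈ (weightedFiltration u w).ideal (k + 1) := by
    rw [← weightedMonomialIdeal_eq_weightedFiltration_ideal, map_sub, hevalP]
    have hsplit : ∑ α ∈ Δ, a α * ∏ i, u i ^ α i =
        ∑ α ∈ Δ.filter (fun α => ∑ i, w i * α i = k), a α * ∏ i, u i ^ α i +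
          ∑ α ∈ Δ.filter (fun α => ¬ ∑ i, w i * α i = k), a α * ∏ i, u i ^ α i :=
      (Finset.sum_filter_add_sum_filter_not Δ _ _).symm
    have hkey : ∑ α ∈ Δ.filter (fun α => ∑ i, w i * α i = k), a α * ∏ i, u i ^ α i - MvPolynomial.eval u Q =
        (f - MvPolynomial.eval u Q) - (f - ∑ α ∈ Δ, a α * ∏ i, u i ^ α i) -
          ∑ α ∈ Δ.filter (fun α => ¬ ∑ i, w i * α i = k), a α * ∏ i, u i ^ α i := by
      rw [hsplit]; ring
    rw [hkey]
    exact Ideal.sub_mem _ (Ideal.sub_mem _ hfQ (hJ hr)) hhigh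
  exact weightedQuasiRegular_of_linearIndependent_toCotangent u w hw hmem hli k (P - Q) hPQ heval β

include hli hw in
/-- **Unit monomials cannot hide in a higher piece (sub-family version).**  If `u` is part of a regular system of
parameters, `f = Σ_{α ∈ Δ} a_α u^α + r`, `a_α` units, `r ∈ (u)^N`, and `f ∈ 𝒥ₘ(u; w)` with `m ≤ N`, then every exponent
of `Δ` has weight `w·α ≥ m`.  [cite: Matsumura1987, Thm. 16.2] -/
theorem le_weight_of_mem_weightedMonomialIdeal_of_linearIndependent {f : S} {Δ : Finset (Fin d → ℕ)}
    {a : (Fin d → ℕ) → S} {N m : ℕ} (hunit : ∀ α ∈ Δ, IsUnit (a α))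
    (hr : f - ∑ α ∈ Δ, a α * ∏ i, u i ^ α i ∈ Ideal.span (Set.range u) ^ N)
    (hf : f ∈ weightedMonomialIdeal u w m) (hmN : m ≤ N) : ∀ α ∈ Δ, m ≤ ∑ i, w i * α i := by
  classical
  suffices H : ∀ k, k ≤ m → ∀ α ∈ Δ, k ≤ ∑ i, w i * α i from H m le_rfl
  intro k
  induction k with
  | zero => intro _ α _; exact Nat.zero_le _
  | succ k ih =>
    intro hkm α hα
    have hge := ih (Nat.le_of_succ_le hkm)
    by_contra hlt
    have heq : ∑ i, w i * α i = k := by have := hge α hα; omega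
    have hfQ : f - MvPolynomial.eval u (0 : MvPolynomial (Fin d) S) ∈ weightedMonomialIdeal u w (k + 1) := by
      rw [map_zero, sub_zero]
      exact weightedMonomialIdeal_antitone u w hkm hf
    have hcoeff := coeff_layer_sub_mem_span u hmem hli w hw hr hge (by omega) 0
      (MvPolynomial.isWeightedHomogeneous_zero S w k) hfQ (Finsupp.equivFunOnFinite.symm α)
    rw [sub_zero, MvPolynomial.coeff_sum, Finset.sum_eq_single α
        (fun α' hα' hne => by
          rw [MvPolynomial.coeff_monomial, if_neg]
          exact fun h => hne (Finsupp.equivFunOnFinite.symm.injective h))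
        (fun h => absurd (Finset.mem_filter.mpr ⟨hα, heq⟩) h),
      MvPolynomial.coeff_monomial, if_pos rfl] at hcoeff
    have hspan : Ideal.span (Set.range u) ≤ maximalIdeal S := by
      rw [Ideal.span_le]; rintro _ ⟨i, rfl⟩; exact hmem i
    exact (mem_maximalIdeal _).mp (hspan hcoeff) (hunit α hα)

include hli in
/-- **A unit monomial of low degree keeps `f` out of `(u)^m`.**  All weights `1`: if `f = Σ_{α ∈ Δ} a_α u^α + r` with unit
coefficients and `r ∈ (u)^N`, and some `α ∈ Δ` has `|α| < m ≤ N`, then `f ∉ (u)^m`.  (In the application `u` is a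
sub-family `(t⁻¹, z, Y')` of the regular parameters of a successor ring `B_𝔫` and `(u)^m ⊇` nothing is claimed about
`𝔪_𝔫^m`; the caller upgrades via `(u) + (units) = 𝔪_𝔫` when `u` is the whole system.) [cite: Matsumura1987, Thm. 16.2] -/
theorem not_mem_pow_span_of_degree_lt {f : S} {Δ : Finset (Fin d → ℕ)} {a : (Fin d → ℕ) → S} {N m : ℕ}
    (hunit : ∀ α ∈ Δ, IsUnit (a α)) (hr : f - ∑ α ∈ Δ, a α * ∏ i, u i ^ α i ∈ Ideal.span (Set.range u) ^ N)
    (hmN : m ≤ N) {α : Fin d → ℕ} (hα : α ∈ Δ) (hlt : ∑ i, α i < m) :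
    f ∉ Ideal.span (Set.range u) ^ m := by
  intro hf
  have hone : ∀ i : Fin d, 0 < (fun _ : Fin d => 1) i := fun _ => one_pos
  have hf' : f ∈ weightedMonomialIdeal u (fun _ => 1) m := by
    rw [weightedMonomialIdeal_one_eq_pow u m]; exact hf
  have h := le_weight_of_mem_weightedMonomialIdeal_of_linearIndependent u hmem hli (fun _ => 1) hone hunit hr hf' hmN
    α hα
  simp only [one_mul] at h
  omega

end Subfamily

end LocalGameEFTNewton

end Summit.ResolutionOfSingularities.ResolutionOfSingularities.Theorems

end
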